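import Mathlib
import HarnessLib.Audit
import Summits.PneNP.PneNP.Theorems.ClusHilbertBound

/-!
# Route ClusUniversalCertificate — the Hilbert deficiency `Φ(Y)` and the Hilbert bound `Σ_y a_ℓ(y) ≤ Φ(Y)` (kernel proof)
(rung F-N1, cell pnp-ideate, crux `UniversalCertAll` = stmt-PneNP-19683; planner p1 g13, `HOME/pnp-ideate-p1/lines/hilbert-TII.md` §1
Theorem 3 and Corollary 4, ROUND-13 §2; the typed statements `hilbertBound` / `sum_dimAt_le_two_Phi` of `lines/hilbert-TII-UNREGISTERED.lean`
with `evalOn`, `HF`, `Phi`, `incrDim` VERBATIM (point type `ClusCube.V N = Fin N → ZMod 2`, p1's `Pt N`); restricted-model combinatorics —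
nothing here bears on `P` versus `NP`)

`HF Y d` is the affine Hilbert function of the point set `Y ⊆ 𝔽₂^N` (the dimension of the degree-`≤ d` polynomials restricted to `Y`) and
`Phi Y = Σ_{d<N} (|Y| − HF_Y(d))` its Hilbert DEFICIENCY — the affine-invariant number that ROUND-13's residual crux (LB-Φ) is stated in.

* `hilbertBound` (**Theorem 3**): for every rank function `r` on the points, `Σ_{y∈Y} a_r(y) ≤ Φ(Y)`, where `a_r(y) = incrDim Y r y` is the largest
  dimension of a linear `U` with `y + U ⊆ Y` all of whose non-zero translates move `y` UP.  Proof in LEVEL FORM (no separator degrees):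
  at level `θ ≥ 1` the indicators of `r`-increasing `θ`-flats at the points of `A ⊆ Y`, restricted to `Y`, are linearly independent (look at the
  `r`-minimal base point) and ORTHOGONAL, for the dot product on `𝔽₂^Y`, to every degree-`≤ θ−1` polynomial restricted to `Y`
  (`sum_flat_eq_zero`: a function of degree `< dim U` sums to zero over every coset of `U` — pair the points by a non-zero `u₀ ∈ U` vanishing on
  the monomial's support); hence `#A ≤ |Y| − HF_Y(θ−1)` (`card_le_card_sub_HF`, via `LinearMap.BilinForm.finrank_orthogonal`), and summing over
  `θ` (layer cake) gives the bound.  The injectivity hypothesis of the sketch is not needed and kept only for the verbatim signature.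
* `sum_dimAt_le_two_Phi` (**Corollary 4**): `Σ_y dim_Y(y) ≤ 2·Φ(Y)` — the lex split `ClusHilbertEchelon.lex_split` and `hilbertBound` for the lex rank
  and its reverse.

(Corollary 6 / `Phi_le_sum_predErr` — `Φ(Y) ≤ Σ_y |φ_g(y)|`, the other half of Theorem 7 — needs the cardinality of the predictor's sublevel sets and
is not typed here; the tree's `ClusHilbertBound.tii` reaches TII without it.)
-/

set_option linter.dupNamespace false -- `Summit.PneNP.PneNP.…`: summit = sub-problem name (D-0017 single-conjunct layout)

namespace Summit.PneNP.PneNP.Theorems.ClusHilbert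

open Finset MvPolynomial
open Summit.PneNP.PneNP.Theorems.ClusCube (V flatInd exists_submodule_finrank_eq sum_eq_sum_card_lt)

variable {N : ℕ}

/-- Every element of `ZMod 2` is `0` or `1`. -/
private theorem zmod2_eq_zero_or_one (z : ZMod 2) : z = 0 ∨ z = 1 := by
  fin_cases z
  · exact Or.inl rfl
  · exact Or.inr rfl

/-! ## The objects (p1's definitions, verbatim) -/

/-- evaluation of polynomials at the points of `Y`, as a linear map to functions on `Y` -/
noncomputable def evalOn (Y : Finset (V N)) :
    MvPolynomial (Fin N) (ZMod 2) →ₗ[ZMod 2] (Y → ZMod 2) where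
  toFun p := fun y => MvPolynomial.eval (y : V N) p
  map_add' := by intro p q; funext y; simp
  map_smul' := by intro c p; funext y; simp

/-- affine Hilbert function `HF_Y(d)` = dimension of the space of degree-`≤ d` polynomials restricted to `Y` -/
noncomputable def HF (Y : Finset (V N)) (d : ℕ) : ℕ :=
  Module.finrank (ZMod 2)
    (Submodule.map (evalOn Y) (MvPolynomial.restrictTotalDegree (Fin N) (ZMod 2) d))

/-- Hilbert deficiency `Φ(Y) = Σ_{d<N} (|Y| − HF_Y(d))` (for `d ≥ N`, `HF_Y(d) = |Y|`) -/
noncomputable def Phi (Y : Finset (V N)) : ℕ :=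
  ∑ d ∈ Finset.range N, (Y.card - HF Y d)

/-- `a_ℓ(y)`: the largest dimension of a linear `U` with `y + U ⊆ Y` all of whose nonzero translates
move `y` UP in the order given by the rank function `r` -/
noncomputable def incrDim (Y : Finset (V N)) (r : V N → ℕ) (y : V N) : ℕ :=
  sSup {k : ℕ | ∃ U : Submodule (ZMod 2) (V N), Module.finrank (ZMod 2) U = k ∧
    (∀ u ∈ U, y + u ∈ Y) ∧ (∀ u ∈ U, u ≠ 0 → r y < r (y + u))}

/-! ## Functions of low degree sum to zero over large flats -/

/-- coordinate projection onto the coordinates in `S` -/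
def projS (S : Finset (Fin N)) : V N →ₗ[ZMod 2] (S → ZMod 2) :=
  LinearMap.pi fun i : S => LinearMap.proj (i : Fin N)

/-- A subspace of dimension `> #S` contains a non-zero vector vanishing on `S`. -/
theorem exists_ne_zero_vanishing (U : Submodule (ZMod 2) (V N)) (S : Finset (Fin N))
    (h : S.card < Module.finrank (ZMod 2) U) : ∃ u ∈ U, u ≠ 0 ∧ ∀ i ∈ S, u i = 0 := by
  by_contra hno
  push Not at hno
  -- then the projection onto `S` is injective on `U`
  have hinj : Function.Injective ((projS S).comp U.subtype) := by
    rw [← LinearMap.ker_eq_bot, LinearMap.ker_eq_bot']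
    intro u hu
    have h0 : ∀ i ∈ S, (u : V N) i = 0 := fun i hi => by
      have := congrFun hu ⟨i, hi⟩
      simpa [projS] using this
    by_contra hne
    obtain ⟨i, hi, hne0⟩ := hno u u.2 (fun h => hne (Subtype.ext h))
    exact hne0 (h0 i hi)
  have hle := LinearMap.finrank_le_finrank_of_injective hinj
  rw [Module.finrank_pi, Fintype.card_coe] at hle
  omega

open scoped Classical in
/-- **A function of degree `< dim U` sums to zero over every coset of `U`.** -/
theorem sum_flat_eq_zero (U : Submodule (ZMod 2) (V N)) {d : ℕ} (hd : d < Module.finrank (ZMod 2) U) (a : V N)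
    {q : V N → ZMod 2} (hq : q ∈ Pdeg (univ : Finset (Fin N)) d) :
    ∑ v ∈ univ.filter (fun v : V N => v - a ∈ U), q v = 0 := by
  classical
  -- the summation functional is linear, so it suffices to treat monomials
  have key : Pdeg (univ : Finset (Fin N)) d ≤
      LinearMap.ker ((∑ v ∈ univ.filter (fun v : V N => v - a ∈ U), LinearMap.proj v :
        (V N → ZMod 2) →ₗ[ZMod 2] ZMod 2)) := by
    refine Submodule.span_le.2 ?_
    rintro f ⟨S, -, hS, rfl⟩
    rw [SetLike.mem_coe, LinearMap.mem_ker, LinearMap.sum_apply]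
    simp only [LinearMap.proj_apply]
    -- pair the points of the coset by a non-zero `u₀ ∈ U` vanishing on `S`
    obtain ⟨u₀, hu₀U, hu₀, hu₀S⟩ := exists_ne_zero_vanishing U S (lt_of_le_of_lt hS hd)
    refine Finset.sum_involution (fun v _ => v + u₀) (fun v _ => ?_) (fun v _ _ => ?_) (fun v hv => ?_) (fun v _ => ?_)
    · have : chi S (v + u₀) = chi S v := by
        unfold chi
        refine prod_congr rfl fun i hi => ?_
        rw [Pi.add_apply, hu₀S i hi, add_zero]
      rw [this]
      generalize chi S v = c; revert c; decide
    · intro h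
      apply hu₀
      have := congrArg (fun w => w - v) h
      simpa using this
    · rw [mem_filter] at hv ⊢
      refine ⟨mem_univ _, ?_⟩
      have : v + u₀ - a = (v - a) + u₀ := by abel
      rw [this]
      exact U.add_mem hv.2 hu₀U
    · have h2 : u₀ + u₀ = 0 := by
        funext i
        rw [Pi.add_apply, Pi.zero_apply]
        generalize u₀ i = c; revert c; decide
      rw [add_assoc, h2, add_zero]
  have h := key hq
  rw [LinearMap.mem_ker, LinearMap.sum_apply] at h
  simpa only [LinearMap.proj_apply] using h

/-! ## The dot product on functions on `Y` -/

/-- the dot product on `Y → 𝔽₂` as a bilinear form -/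
noncomputable def dotY (Y : Finset (V N)) : LinearMap.BilinForm (ZMod 2) (Y → ZMod 2) :=
  LinearMap.mk₂ (ZMod 2) (fun f g => ∑ v, f v * g v)
    (fun f f' g => by simp only [Pi.add_apply, add_mul, sum_add_distrib])
    (fun c f g => by simp only [Pi.smul_apply, smul_eq_mul, mul_assoc, mul_sum])
    (fun f g g' => by simp only [Pi.add_apply, mul_add, sum_add_distrib])
    (fun c f g => by simp only [Pi.smul_apply, smul_eq_mul, mul_sum, mul_left_comm])

/-- Unfolding `dotY`. -/
@[simp] theorem dotY_apply (Y : Finset (V N)) (f g : Y → ZMod 2) : dotY Y f g = ∑ v, f v * g v := rfl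

/-- The dot product is non-degenerate. -/
theorem dotY_nondegenerate (Y : Finset (V N)) : (dotY Y).Nondegenerate := by
  classical
  constructor
  · intro f hf
    funext v
    have := hf (Pi.single v 1)
    rw [dotY_apply, Fintype.sum_eq_single v (fun w hw => by rw [Pi.single_eq_of_ne hw, mul_zero])] at this
    simpa using this
  · intro g hg
    funext v
    have := hg (Pi.single v 1)
    rw [dotY_apply, Fintype.sum_eq_single v (fun w hw => by rw [Pi.single_eq_of_ne hw, zero_mul])] at this
    simpa using this

/-! ## Level form of the Hilbert bound: `#A ≤ |Y| − HF_Y(θ − 1)` -/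

/-- **Level `θ` of the Hilbert bound.**  If every point of `A` carries an `r`-increasing `θ`-dimensional flat inside `Y` (`θ ≥ 1`), then
`#A + HF_Y(θ−1) ≤ |Y|`: the flats' indicators restricted to `Y` are independent and orthogonal to every degree-`≤ θ−1` polynomial. -/
theorem card_add_HF_le_card {β : Type*} [LinearOrder β] (r : V N → β) (Y A : Finset (V N)) (θ : ℕ) (hθ : 1 ≤ θ)
    (Va : V N → Submodule (ZMod 2) (V N))
    (hinc : ∀ a ∈ A, ∀ v ∈ Va a, v ≠ 0 → r a < r (a + v))
    (hdim : ∀ a ∈ A, Module.finrank (ZMod 2) (Va a) = θ)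
    (hY : ∀ a ∈ A, ∀ v ∈ Va a, a + v ∈ Y) :
    A.card + HF Y (θ - 1) ≤ Y.card := by
  classical
  set W := Submodule.map (evalOn Y) (MvPolynomial.restrictTotalDegree (Fin N) (ZMod 2) (θ - 1)) with hW
  set K := (dotY Y).orthogonal W with hK
  -- the rows: indicators of the flats, restricted to `Y`
  let row : A → (Y → ZMod 2) := fun a v => flatInd (a : V N) (Va a) v
  -- (i) each row is orthogonal to `W`
  have hrowK : ∀ a : A, row a ∈ K := by
    intro a
    rw [hK, LinearMap.BilinForm.mem_orthogonal_iff]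
    intro w hw
    obtain ⟨p, hp, rfl⟩ := Submodule.mem_map.mp hw
    rw [MvPolynomial.mem_restrictTotalDegree] at hp
    rw [dotY_apply]
    -- the sum over `Y` of `p · 1_{flat}` is the sum of `p` over the flat
    have hflat : ∑ v : Y, evalOn Y p v * row a v =
        ∑ v ∈ univ.filter (fun v : V N => v - (a : V N) ∈ Va a), MvPolynomial.eval v p := by
      have h1 : ∑ v : Y, evalOn Y p v * row a v = ∑ v ∈ Y, (MvPolynomial.eval v p * flatInd (a : V N) (Va a) v) :=
        Finset.sum_coe_sort Y (fun v => MvPolynomial.eval v p * flatInd (a : V N) (Va a) v)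
      rw [h1]
      have h2 : ∑ v ∈ Y, MvPolynomial.eval v p * flatInd (a : V N) (Va a) v =
          ∑ v ∈ Y.filter (fun v => v - (a : V N) ∈ Va a), MvPolynomial.eval v p := by
        rw [sum_filter]
        refine sum_congr rfl fun v _ => ?_
        unfold flatInd
        split_ifs <;> simp
      rw [h2]
      congr 1
      ext v
      simp only [mem_filter, mem_univ, true_and, and_iff_right_iff_imp]
      intro hv
      have := hY a a.2 _ hv
      rwa [add_sub_cancel] at this
    rw [hflat]
    exact sum_flat_eq_zero (Va a) (by rw [hdim a a.2]; omega) _ (eval_mem_Pdeg p hp)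
  -- (ii) the rows are linearly independent
  have hli : LinearIndependent (ZMod 2) row := by
    rw [linearIndependent_iff']
    intro s c hsum a ha
    by_contra hca
    let F : V N → ZMod 2 := fun x => ∑ a ∈ s, c a * flatInd (a : V N) (Va a) x
    have hF0 : ∀ x : V N, F x = 0 := by
      intro x
      by_cases hxY : x ∈ Y
      · have := congrFun hsum ⟨x, hxY⟩
        simpa [row, Finset.sum_apply, Pi.smul_apply, smul_eq_mul] using this
      · refine sum_eq_zero fun a _ => ?_
        have : flatInd (a : V N) (Va a) x = 0 := by
          unfold flatInd
          rw [if_neg]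
          intro hmem
          have := hY a a.2 _ hmem
          rw [add_sub_cancel] at this
          exact hxY this
        rw [this, mul_zero]
    set S' := s.filter fun a => c a ≠ 0 with hS'
    have hne : S'.Nonempty := ⟨a, by rw [hS']; exact mem_filter.mpr ⟨ha, hca⟩⟩
    obtain ⟨a₀, ha₀, hmin⟩ := S'.exists_min_image (fun a => r (a : V N)) hne
    have ha₀s : a₀ ∈ s := (mem_filter.mp ha₀).1
    have hca₀ : c a₀ ≠ 0 := (mem_filter.mp ha₀).2
    have hFa₀ : F a₀ = c a₀ := by
      simp only [F]
      rw [sum_eq_single_of_mem a₀ ha₀s]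
      · unfold flatInd
        rw [sub_self, if_pos (Submodule.zero_mem _), mul_one]
      · intro a has hne'
        by_cases hc : c a = 0
        · rw [hc, zero_mul]
        · have haS' : a ∈ S' := by rw [hS']; exact mem_filter.mpr ⟨has, hc⟩
          unfold flatInd
          rw [if_neg, mul_zero]
          intro hv
          have hne0 : (a₀ : V N) - (a : V N) ≠ 0 := fun h => hne' (Subtype.ext (sub_eq_zero.mp h)).symm
          have hlt := hinc a a.2 _ hv hne0
          rw [add_sub_cancel] at hlt
          exact absurd (hmin a haS') (not_le.mpr hlt)
    exact hca₀ (hFa₀ ▸ hF0 a₀)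
  -- (iii) count dimensions inside `K`
  have hliK : LinearIndependent (ZMod 2) (fun a : A => (⟨row a, hrowK a⟩ : K)) :=
    LinearIndependent.of_comp K.subtype (by exact hli)
  have h1 := hliK.fintype_card_le_finrank
  rw [Fintype.card_coe] at h1
  have h2 : Module.finrank (ZMod 2) K = Module.finrank (ZMod 2) (Y → ZMod 2) - Module.finrank (ZMod 2) W :=
    LinearMap.BilinForm.finrank_orthogonal (dotY_nondegenerate Y) W
  have h3 : Module.finrank (ZMod 2) W ≤ Module.finrank (ZMod 2) (Y → ZMod 2) := Submodule.finrank_le W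
  rw [Module.finrank_pi, Fintype.card_coe] at h2 h3
  have h4 : HF Y (θ - 1) = Module.finrank (ZMod 2) W := rfl
  omega

/-! ## Theorem 3 -/

/-- The `sSup` defining `incrDim` is attained. -/
theorem exists_incr_direction (Y : Finset (V N)) (r : V N → ℕ) {y : V N} (hy : y ∈ Y) :
    ∃ U : Submodule (ZMod 2) (V N), Module.finrank (ZMod 2) U = incrDim Y r y ∧
      (∀ u ∈ U, y + u ∈ Y) ∧ (∀ u ∈ U, u ≠ 0 → r y < r (y + u)) := by
  set S := {k : ℕ | ∃ U : Submodule (ZMod 2) (V N), Module.finrank (ZMod 2) U = k ∧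
    (∀ u ∈ U, y + u ∈ Y) ∧ (∀ u ∈ U, u ≠ 0 → r y < r (y + u))} with hS
  have hne : S.Nonempty := ⟨0, ⊥, finrank_bot _ _, fun u hu => by
    rw [Submodule.mem_bot] at hu; rw [hu, add_zero]; exact hy, fun u hu hu0 => by
    rw [Submodule.mem_bot] at hu; exact absurd hu hu0⟩
  have hbdd : BddAbove S := by
    refine ⟨N, fun k hk => ?_⟩
    obtain ⟨U, hk, -, -⟩ := hk
    rw [← hk]
    exact (Submodule.finrank_le _).trans (by simp)
  obtain ⟨U, hk, hUY, hinc⟩ := Nat.sSup_mem hne hbdd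
  exact ⟨U, hk, hUY, hinc⟩

/-- `incrDim` is at most the ambient dimension. -/
theorem incrDim_le (Y : Finset (V N)) (r : V N → ℕ) {y : V N} (hy : y ∈ Y) : incrDim Y r y ≤ N := by
  obtain ⟨U, hk, -, -⟩ := exists_incr_direction Y r hy
  rw [← hk]
  exact (Submodule.finrank_le _).trans (by simp)

/-- **Theorem 3 (Hilbert bound): `Σ_y a_ℓ(y) ≤ Φ(Y)`** for every order (injective rank function on `Y`; injectivity is not used). -/
theorem hilbertBound (Y : Finset (V N)) (r : V N → ℕ) (_hr : Set.InjOn r Y) :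
    ∑ y ∈ Y, incrDim Y r y ≤ Phi Y := by
  classical
  have hdom : ∀ θ, (Y.filter fun y => θ < incrDim Y r y).card ≤ Y.card - HF Y θ := by
    intro θ
    set A := Y.filter fun y => θ < incrDim Y r y with hA
    have hex : ∀ a : V N, ∃ U' : Submodule (ZMod 2) (V N), a ∈ A →
        (Module.finrank (ZMod 2) U' = θ + 1 ∧ (∀ u ∈ U', a + u ∈ Y) ∧ (∀ u ∈ U', u ≠ 0 → r a < r (a + u))) := by
      intro a
      by_cases ha : a ∈ A
      · obtain ⟨U, hk, hUY, hinc⟩ := exists_incr_direction Y r (mem_filter.mp ha).1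
        obtain ⟨U', h1, h2⟩ := exists_submodule_finrank_eq U (θ + 1) (by rw [hk]; exact (mem_filter.mp ha).2)
        exact ⟨U', fun _ => ⟨h2, fun u hu => hUY u (h1 hu), fun u hu hu0 => hinc u (h1 hu) hu0⟩⟩
      · exact ⟨⊥, fun h => absurd h ha⟩
    choose Va hVa using hex
    have key := card_add_HF_le_card r Y A (θ + 1) (by omega) Va (fun a ha => (hVa a ha).2.2) (fun a ha => (hVa a ha).1)
      (fun a ha => (hVa a ha).2.1)
    rw [Nat.add_sub_cancel] at key
    omega
  unfold Phi
  rw [sum_eq_sum_card_lt Y (incrDim Y r) (fun y hy => incrDim_le Y r hy)]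
  exact sum_le_sum fun θ _ => hdom θ

/-! ## Corollary 4 -/

/-- **Corollary 4: `Σ_y dim_Y(y) ≤ 2·Φ(Y)`.**  Proof through rank functions into an arbitrary linear order (`hilbertBound'`), applied to
the lex rank and its reverse with the lex split of `ClusHilbertEchelon`. -/
theorem hilbertBound' {β : Type*} [LinearOrder β] (Y : Finset (V N)) (r : V N → β) (U : V N → Submodule (ZMod 2) (V N))
    (hY : ∀ y ∈ Y, ∀ u ∈ U y, y + u ∈ Y) (hinc : ∀ y ∈ Y, ∀ u ∈ U y, u ≠ 0 → r y < r (y + u)) :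
    ∑ y ∈ Y, Module.finrank (ZMod 2) (U y) ≤ Phi Y := by
  classical
  have hdom : ∀ θ, (Y.filter fun y => θ < Module.finrank (ZMod 2) (U y)).card ≤ Y.card - HF Y θ := by
    intro θ
    set A := Y.filter fun y => θ < Module.finrank (ZMod 2) (U y) with hA
    have hex : ∀ a : V N, ∃ U' : Submodule (ZMod 2) (V N), a ∈ A → (U' ≤ U a ∧ Module.finrank (ZMod 2) U' = θ + 1) := by
      intro a
      by_cases ha : a ∈ A
      · obtain ⟨U', h1, h2⟩ := exists_submodule_finrank_eq (U a) (θ + 1) (mem_filter.mp ha).2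
        exact ⟨U', fun _ => ⟨h1, h2⟩⟩
      · exact ⟨⊥, fun h => absurd h ha⟩
    choose Va hVa using hex
    have key := card_add_HF_le_card r Y A (θ + 1) (by omega) Va
      (fun a ha v hv hv0 => hinc a (mem_filter.mp ha).1 v ((hVa a ha).1 hv) hv0) (fun a ha => (hVa a ha).2)
      (fun a ha v hv => hY a (mem_filter.mp ha).1 v ((hVa a ha).1 hv))
    rw [Nat.add_sub_cancel] at key
    omega
  unfold Phi
  rw [sum_eq_sum_card_lt Y (fun y => Module.finrank (ZMod 2) (U y)) (fun y _ => (Submodule.finrank_le _).trans (by simp))]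
  exact sum_le_sum fun θ _ => hdom θ

/-- **Corollary 4: `Σ_y dim_Y(y) ≤ 2·Φ(Y)`.** -/
theorem sum_dimAt_le_two_Phi (Y : Finset (V N)) : ∑ y ∈ Y, dimAt Y y ≤ 2 * Phi Y := by
  classical
  have hex : ∀ y : V N, ∃ W : Submodule (ZMod 2) (V N),
      y ∈ Y → ((∀ w ∈ W, y + w ∈ Y) ∧ Module.finrank (ZMod 2) W = dimAt Y y) := by
    intro y
    by_cases hy : y ∈ Y
    · obtain ⟨W, h1, h2⟩ := exists_direction Y hy
      exact ⟨W, fun _ => ⟨h1, h2⟩⟩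
    · exact ⟨⊥, fun h => absurd h hy⟩
  choose W hW using hex
  have hsp : ∀ y : V N, ∃ U : Submodule (ZMod 2) (V N) × Submodule (ZMod 2) (V N),
      U.1 ≤ W y ∧ U.2 ≤ W y ∧
      Module.finrank (ZMod 2) (W y) ≤ Module.finrank (ZMod 2) U.1 + Module.finrank (ZMod 2) U.2 ∧
      (∀ u ∈ U.1, u ≠ 0 → ∃ t, (∀ i, i < t → u i = 0) ∧ u t ≠ 0 ∧ y t = 0) ∧
      (∀ u ∈ U.2, u ≠ 0 → ∃ t, (∀ i, i < t → u i = 0) ∧ u t ≠ 0 ∧ y t ≠ 0) := by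
    intro y
    obtain ⟨U₁, U₂, h⟩ := lex_split y (W y)
    exact ⟨(U₁, U₂), h⟩
  choose U hU using hsp
  have hup : ∑ y ∈ Y, Module.finrank (ZMod 2) (U y).1 ≤ Phi Y := by
    refine hilbertBound' Y lexRank (fun y => (U y).1) (fun y hy u hu => (hW y hy).1 u ((hU y).1 hu)) (fun y _ u hu hu0 => ?_)
    obtain ⟨t, hz, hut, hyt⟩ := (hU y).2.2.2.1 u hu hu0
    exact lexRank_lt_of_lead_zero hz hut hyt
  have hdown : ∑ y ∈ Y, Module.finrank (ZMod 2) (U y).2 ≤ Phi Y := by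
    refine hilbertBound' Y (fun y => OrderDual.toDual (lexRank y)) (fun y => (U y).2)
      (fun y hy u hu => (hW y hy).1 u ((hU y).2.1 hu)) (fun y _ u hu hu0 => ?_)
    obtain ⟨t, hz, hut, hyt⟩ := (hU y).2.2.2.2 u hu hu0
    exact OrderDual.toDual_lt_toDual.mpr (lexRank_add_lt_of_lead_one hz hut hyt)
  calc ∑ y ∈ Y, dimAt Y y = ∑ y ∈ Y, Module.finrank (ZMod 2) (W y) := sum_congr rfl fun y hy => (hW y hy).2.symm
    _ ≤ ∑ y ∈ Y, (Module.finrank (ZMod 2) (U y).1 + Module.finrank (ZMod 2) (U y).2) := sum_le_sum fun y _ => (hU y).2.2.1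
    _ = ∑ y ∈ Y, Module.finrank (ZMod 2) (U y).1 + ∑ y ∈ Y, Module.finrank (ZMod 2) (U y).2 := sum_add_distrib
    _ ≤ Phi Y + Phi Y := add_le_add hup hdown
    _ = 2 * Phi Y := by ring

end Summit.PneNP.PneNP.Theorems.ClusHilbert
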